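import Mathlib.RingTheory.Ideal.GoingUp
import Mathlib.RingTheory.LocalRing.ResidueField.Basic
import Mathlib.RingTheory.LocalRing.RingHom.Basic
import Mathlib.RingTheory.TensorProduct.Finite
import HarnessLib

/-!
# Base change of an AUGMENTED finite local algebra along a local homomorphism of local rings is local ([Tate1997FiniteFlatGroupSchemes] (3.7))

Topic `Literature/RingTheory/Henselian`; namespace `Literature.RingTheory.Henselian`.  PROOF FILE (theorems only; no definition, no named fact, no
instance, no notation, no `sorry`; Mathlib-only imports).  Cell `hodgecm-mathlib` (D-0151 ∕ D-0183 FLOOR 0), P6 «MOD programme», sub-line P6b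
`Cruxes/HLiu418/Lines/F0_P6b_ConnectedEtale.lean`, organ **(b1g) «UNIT COMPONENT BASE CHANGE»** (desk F0P6b-plan (g0) 13:58:07Z (C); DICT's bridge
`(G_κ̄)⁰ = (G⁰)_κ̄`): this file is its ALGEBRA — the coordinate ring `Γ(G⁰)` of the unit component of a finite group scheme over a henselian local
ring `R` is a module-finite LOCAL `R`-algebra AUGMENTED by the unit section, and such algebras stay local under base change along LOCAL maps
`R → R'`; companion of ★ `Henselian/FiniteLocalAlgebraTensorProduct` ([Tate1997FiniteFlatGroupSchemes] (3.7) Lemma 2, the case of two FINITE local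
factors; here the second factor `R'` is an arbitrary local `R`-algebra, e.g. `κ̄` or `𝒪_Ω`, NOT finite over `R`).  No henselian hypothesis is needed
HERE.  `--supports stmt-HodgeConjecture-24832`; COUNT-NEUTRAL: HC_CM is proved only modulo the printed citations until rung 0 closes.

For a local ring `R`, a LOCAL `R`-algebra `R'` with `R → R'` local, and a module-finite LOCAL `R`-algebra `B` with an augmentation `ε : B →ₐ[R] R`:
* **`isLocalRing_baseChange_of_augmented`** — `R' ⊗[R] B` is a local ring; **`isLocalRing_baseChange_of_augmented'`** — so is `B ⊗[R] R'`.
Proof: every maximal ideal `𝔐` of `C = R' ⊗[R] B` (module-finite over `R'`) lies over `𝔪_{R'}`, so `𝔐 ∩ B ⊇ 𝔪_R B` (`R → R'` local) lies over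
`𝔪_R`, hence is the maximal ideal of `B` (integrality) and contains `ker ε`; the augmentation splits `B = R·1 ⊕ ker ε`, so every element of `C` is a
scalar modulo `(ker ε)C ⊆ 𝔐`, whence `𝔐` is the preimage of `𝔪_{R'}` under `ε ⊗ R' : C ↠ R'` — unique.  Sharp: fails for `R → R'` not local
(`μ_p ⊗_{ℤ_p} ℚ_p` splits) and without the augmentation (residue extension).

## References
* [Tate1997FiniteFlatGroupSchemes] J. Tate, *Finite flat group schemes*, in *Modular Forms and Fermat's Last Theorem* (Springer 1997), (3.7)
  (the unit component `G⁰` and its behaviour under base change), Lemma 2 of the proof of (I).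
* [StacksProject] The Stacks Project, Tag 04GG (finite algebras over henselian local rings).
-/

set_option autoImplicit false

noncomputable section

universe u v w

open IsLocalRing TensorProduct

namespace Literature.RingTheory.Henselian

section AugmentedBaseChange

variable {R : Type u} [CommRing R] [IsLocalRing R]
  {R' : Type v} [CommRing R'] [IsLocalRing R'] [Algebra R R'] [IsLocalHom (algebraMap R R')]
  {B : Type w} [CommRing B] [Algebra R B] [IsLocalRing B] [Module.Finite R B]

/-- **The base change `R' ⊗[R] B` of an AUGMENTED module-finite LOCAL `R`-algebra `B` (augmentation `ε : B → R` over `R`) along a LOCAL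
homomorphism of local rings `R → R'` is a LOCAL ring.**  ([Tate1997FiniteFlatGroupSchemes] (3.7): the unit component of a finite group
scheme stays connected under such base changes; [StacksProject] Tag 04GG.)  Proof: let `𝔐` be a maximal ideal of `C = R' ⊗[R] B`.  `C` is
module-finite over `R'`, so `𝔐 ∩ R' = 𝔪_{R'}`; since `R → R'` is local, `𝔐 ∩ B ⊇ 𝔪_R B`, so the prime `𝔐 ∩ B` lies over `𝔪_R`, hence is
maximal (`B` integral over `R`), hence `= 𝔪_B ⊇ ker ε`.  Every element of `C` is a scalar plus an element of `(ker ε)C` (the augmentation splits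
`B = R ⊕ ker ε`), so `ker (ε ⊗ R') ⊆ (ker ε)C ⊆ 𝔐`, and `𝔐` is the preimage of `𝔪_{R'}` under the surjection `ε ⊗ R' : C → R'`: the maximal
ideal is unique.  WITHOUT the augmentation (residue field of `B` bigger than `κ(R)`) or with `R → R'` not local (`R' = Frac R`) this fails
(`μ_p` over `ℤ_p` base-changed to `ℚ_p` splits). [cite: Tate1997FiniteFlatGroupSchemes, (3.7)] [cite: StacksProject, Tag 04GG] -/
theorem isLocalRing_baseChange_of_augmented (ε : B →ₐ[R] R) : IsLocalRing (R' ⊗[R] B) := by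
  classical
  -- the augmentation base-changed: `π : R' ⊗[R] B → R'`, `r ⊗ b ↦ r · ε(b)`
  let πa : R' ⊗[R] B →ₐ[R'] R' :=
    Algebra.TensorProduct.lift (AlgHom.id R' R') ((Algebra.ofId R R').comp ε) fun _ _ => Commute.all _ _
  let π : R' ⊗[R] B →+* R' := πa.toRingHom
  have hπt : ∀ (r : R') (b : B), π (r ⊗ₜ b) = r * algebraMap R R' (ε b) := fun r b => by
    simp [π, πa, Algebra.TensorProduct.lift_tmul, Algebra.ofId_apply]
  have hπ : Function.Surjective π := fun r => ⟨r ⊗ₜ 1, by rw [hπt, map_one, map_one, mul_one]⟩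
  set N : Ideal (R' ⊗[R] B) :=
    (RingHom.ker (ε : B →+* R)).map (Algebra.TensorProduct.includeRight : B →ₐ[R] R' ⊗[R] B) with hN
  -- every element is a scalar plus an element of `N = (ker ε) · (R' ⊗ B)`: `x - π(x) · 1 ∈ N`
  have hsub : ∀ x : R' ⊗[R] B, x - algebraMap R' (R' ⊗[R] B) (π x) ∈ N := fun x => by
    induction x using TensorProduct.induction_on with
    | zero => simp
    | tmul r b =>
      have hb : b - algebraMap R B (ε b) ∈ RingHom.ker (ε : B →+* R) := by
        rw [RingHom.mem_ker, RingHom.coe_coe, map_sub, AlgHom.commutes]; exact sub_self _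
      have e2 : (r * algebraMap R R' (ε b)) ⊗ₜ[R] (1 : B) = r ⊗ₜ[R] algebraMap R B (ε b) := by
        rw [mul_comm, ← Algebra.smul_def, TensorProduct.smul_tmul, Algebra.algebraMap_eq_smul_one]
      have h1 : r ⊗ₜ[R] b - algebraMap R' (R' ⊗[R] B) (π (r ⊗ₜ b)) =
          (r ⊗ₜ[R] (1 : B)) * (Algebra.TensorProduct.includeRight (R := R) (A := R') (b - algebraMap R B (ε b))) := by
        rw [hπt, Algebra.TensorProduct.algebraMap_apply, Algebra.algebraMap_self, RingHom.id_apply, e2,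
          Algebra.TensorProduct.includeRight_apply, Algebra.TensorProduct.tmul_mul_tmul, mul_one, one_mul, TensorProduct.tmul_sub]
      rw [h1]
      exact Ideal.mul_mem_left _ _ (Ideal.mem_map_of_mem _ hb)
    | add x y hx hy =>
      have : x + y - algebraMap R' (R' ⊗[R] B) (π (x + y)) =
          (x - algebraMap R' (R' ⊗[R] B) (π x)) + (y - algebraMap R' (R' ⊗[R] B) (π y)) := by
        rw [map_add, map_add]; ring
      rw [this]
      exact Ideal.add_mem _ hx hy
  -- `ker π ≤ N`
  have hkerN : RingHom.ker π ≤ N := fun x hx => by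
    have h := hsub x
    rw [RingHom.mem_ker] at hx
    rwa [hx, map_zero, sub_zero] at h
  -- every maximal ideal contains `N`
  have hNle : ∀ 𝔐 : Ideal (R' ⊗[R] B), 𝔐.IsMaximal → N ≤ 𝔐 := by
    intro 𝔐 h𝔐
    haveI := h𝔐
    -- `𝔐 ∩ R' = 𝔪_{R'}`
    have h1 : (𝔐.comap (algebraMap R' (R' ⊗[R] B))).IsMaximal := Ideal.isMaximal_comap_of_isIntegral_of_isMaximal 𝔐
    have h1' : 𝔐.comap (algebraMap R' (R' ⊗[R] B)) = maximalIdeal R' := IsLocalRing.eq_maximalIdeal h1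
    -- the prime `P = 𝔐 ∩ B` contains `𝔪_R B`
    set P : Ideal B := 𝔐.comap (Algebra.TensorProduct.includeRight : B →ₐ[R] R' ⊗[R] B) with hP
    haveI hPp : P.IsPrime := Ideal.IsPrime.comap _
    have h2 : (P.comap (algebraMap R B)).IsMaximal := by
      have hle : maximalIdeal R ≤ P.comap (algebraMap R B) := fun m hm => by
        rw [Ideal.mem_comap, hP, Ideal.mem_comap]
        have e1 : (Algebra.TensorProduct.includeRight : B →ₐ[R] R' ⊗[R] B) (algebraMap R B m) =
            algebraMap R' (R' ⊗[R] B) (algebraMap R R' m) := by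
          rw [AlgHom.commutes, IsScalarTower.algebraMap_apply R R' (R' ⊗[R] B)]
        rw [e1, ← Ideal.mem_comap, h1']
        exact map_nonunit (algebraMap R R') m hm
      have hne : P.comap (algebraMap R B) ≠ ⊤ := fun htop =>
        hPp.ne_top (by rw [Ideal.eq_top_iff_one, ← (algebraMap R B).map_one, ← Ideal.mem_comap, htop]; trivial)
      rw [((maximalIdeal.isMaximal R).eq_of_le hne hle).symm]
      exact maximalIdeal.isMaximal R
    -- hence `P` is maximal, `P = 𝔪_B ⊇ ker ε`
    have h3 : P.IsMaximal := Ideal.isMaximal_of_isIntegral_of_isMaximal_comap P h2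
    have h4 : RingHom.ker (ε : B →+* R) ≤ P := by
      rw [IsLocalRing.eq_maximalIdeal h3]
      exact IsLocalRing.le_maximalIdeal (RingHom.ker_ne_top _)
    rw [hN, Ideal.map_le_iff_le_comap]
    exact h4
  -- the unique maximal ideal: the preimage of `𝔪_{R'}` under `π`
  refine IsLocalRing.of_unique_max_ideal ⟨(maximalIdeal R').comap π,
    Ideal.comap_isMaximal_of_surjective π hπ, fun 𝔐 h𝔐 => ?_⟩
  have hker : RingHom.ker π ≤ 𝔐 := hkerN.trans (hNle 𝔐 h𝔐)
  have e1 : 𝔐 = (𝔐.map π).comap π := by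
    rw [Ideal.comap_map_of_surjective π hπ, left_eq_sup]
    rwa [← RingHom.ker_eq_comap_bot]
  have e2 : (𝔐.map π).IsMaximal := by
    have hne : 𝔐.map π ≠ ⊤ := fun htop => h𝔐.ne_top (by rw [e1, htop, Ideal.comap_top])
    exact (Ideal.map_eq_top_or_isMaximal_of_surjective π hπ h𝔐).resolve_left hne
  rw [e1, IsLocalRing.eq_maximalIdeal e2]

/-- The same in the other orientation: `B ⊗[R] R'` is a local ring. [cite: Tate1997FiniteFlatGroupSchemes, (3.7)] [cite: StacksProject, Tag 04GG] -/
theorem isLocalRing_baseChange_of_augmented' (ε : B →ₐ[R] R) : IsLocalRing (B ⊗[R] R') := by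
  haveI := isLocalRing_baseChange_of_augmented (R' := R') ε
  haveI : Nontrivial (B ⊗[R] R') := (Algebra.TensorProduct.comm R B R').surjective.nontrivial
  exact IsLocalRing.of_surjective' (Algebra.TensorProduct.comm R R' B).toRingEquiv.toRingHom
    (Algebra.TensorProduct.comm R R' B).toRingEquiv.surjective

end AugmentedBaseChange

end Literature.RingTheory.Henselian

end
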